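import Literature.Probability.Percolation.FiveMarkedS0HexBall1
import Literature.Probability.Percolation.ColourSwitching
import Mathlib.RingTheory.RootsOfUnity.Complex
import HarnessLib

/-!
# Five-point discrete holomorphicity on the smallest five-marked domain: a kernel witness

Topic `Literature/Probability/Percolation`; lane pcv-sawmu (CriticalPhenomena), door (v) «five-point observables on the
honeycomb», module (v-b′) (lead g8 r126). For the interface-layer observables of `FiveMarkedLoops.lean` (D1-v2:
`patternProb`, `sparseObs`, `tau`, `ccwNbr`) on the 7-site five-marked domain `hexBall1Five` (`TriHexBallDomain.lean`), the
five-point HOLOMORPHICITY relation (H) of the lane's blind search (MINING-PREREG Am. AE, D6-PILOT §9) holds at the centre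
face: `Σ_{k<3} τ^k F_0(v, ccwNbr v k) = 0` for `v = (0,0)▵`, colour `false` — a parafermionic-type local linear relation
with constant complex coefficients `(1, τ, τ²)` between nine pattern-resolved connection probabilities of critical site
percolation (`fivePointHolomorphy_hexBall1Five_centre`). The general statement (every five-marked domain, every interior
face) is a typed conjecture of the lane kept OUTSIDE the tree; this file proves one instance, entirely inside the kernel
(`decide +kernel`, standard axioms, no `native_decide`).

Method. Part X is an index-based evaluator for `hexBall1Five` (faces as indices `0..23`, the 60 directed `H_G`-edges
with their bonds, live edges under a boundary condition, SELF-CERTIFYING closures `closeF` that carry a convergence flag)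
with the proved equivalences `InInterface ↔ index ∈ IPF`, `Joined ↔ index ∈ JF` (b-step0 gen 8). Part H adds the match
closure `MF` with `MatchA/MatchB ↔ index ∈ MF`, the locality of the pattern event and `patternProb` as a count over the open
sets (`patternProb_eq_card`, via `sitePercolation_half_real_eq_card_powerset`), a triple-valued indicator `valH` whose
three kernel sums give the nine counts `34,33,25 | 6,15,8 | 6,0,0` of `2^7` while certifying that every closure
converged, the cyclotomic fact `τ² + τ + 1 = 0` (`Complex.isPrimitiveRoot_exp`), and the assembly
`128·Σ = 34 + 27τ + 19τ² − 15τ³ − 8τ⁴ = (τ²+τ+1)(−8τ²−7τ+34) = 0`.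

Status in print (lane label cell, lit-2): the printed analogue is Khristoforov–Smirnov 2021 §2, Definition 3 (three
boundary mid-edges `u₁, u₂, u₃` in counterclockwise order, `τ = e^{2πi/3}`, `F(z) = Σ_{j=1}^{3} τ^j H_j(z)` with
`H_j(z) = P^loop[z ↔ u_j]`) and **Lemma 4 (Discrete holomorphicity)**, p. 5: «Let `z₁, z₂, z₃` be three mid-edges around
a vertex `v` indexed in the counterclockwise order, then `Σ_{k=1}^{3} τ^k F(z_k) = 0`», proved by grouping the loop
configurations in triples whose members differ by two half-edges adjacent to `v`, each triple contributing zero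
[cite: KhristoforovSmirnov2021, §2 Definition 3 and Lemma 4 (p. 5)]. The relation (H) of this file has the same
three-term `τ`-shape and the same counterclockwise indexing, for the sparse observable with FIVE boundary marks (two more
than in print); no such relation with five boundary marks is stated in print (KhS21 §1 p. 3 announces multi-point
generalisations only) — it is the lane's finding (blind search Am. AE), pilot-exact on rhombi, exact on all 60
(face, j, colour) cells of `hexBall1Five`, kernel-certified here at the centre face. Everything here is finite
bookkeeping over Bollobás–Riordan's marked discrete domains [cite: BollobasRiordan2006, Ch. 7 §7.2.2]; no new
mathematics beyond the certificate.

## References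
* M. Khristoforov, S. Smirnov, *Percolation and O(1) loop model*, arXiv:2111.15612 (2021), §1.2 (loop configurations,
  Lemma 2, pp. 3–4) and §2 (Definition 3, Lemma 4 «Discrete holomorphicity», p. 5).
* B. Bollobás, O. Riordan, *Percolation*, CUP (2006), Ch. 7 §7.2.2 pp. 168–171, proof of Lemma 6 p. 175.
-/

open Finset Literature.Probability.LatticeModels

noncomputable section

namespace Literature.Probability.Percolation.FivePoint.S0

open Literature.Probability.Percolation Literature.Probability.Percolation.FivePoint

set_option maxRecDepth 400000

/-! ## Part X — index evaluator on `hexBall1Five` (faces as indices; self-certifying closures) -/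

/-! ### C8. Index-based evaluator (faces as indices 0..23) — performance layer -/

/-- Index-layer bookkeeping on `hexBall1Five`. [folklore] -/
def faceL : List HexVertex :=
  [(![-2, -1], 1), (![-2, 0], 0), (![-2, 0], 1), (![-2, 1], 0), (![-2, 1], 1), (![-1, -2], 1), (![-1, -1], 0), (![-1, -1], 1),
   (![-1, 0], 0), (![-1, 0], 1), (![-1, 1], 0), (![-1, 1], 1), (![0, -2], 0), (![0, -2], 1), (![0, -1], 0), (![0, -1], 1),
   (![0, 0], 0), (![0, 0], 1), (![0, 1], 0), (![1, -2], 0), (![1, -2], 1), (![1, -1], 0), (![1, -1], 1), (![1, 0], 0)]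
/-- The 60 directed `H_G`-edges of `hexBall1Five` as index pairs into `faceL`, each with its common bond `(u, v)`. [folklore] -/
def edgeTabI : List (ℕ × ℕ × Site 2 × Site 2) :=
  [(0, 1, ![-2, 0], ![-1, 0]), (0, 6, ![-1, -1], ![-1, 0]), (1, 0, ![-2, 0], ![-1, 0]), (1, 2, ![-2, 1], ![-1, 0]),
   (2, 3, ![-2, 1], ![-1, 1]), (2, 1, ![-2, 1], ![-1, 0]), (2, 8, ![-1, 0], ![-1, 1]), (3, 2, ![-2, 1], ![-1, 1]),
   (3, 4, ![-2, 2], ![-1, 1]), (4, 3, ![-2, 2], ![-1, 1]), (4, 10, ![-1, 1], ![-1, 2]), (5, 6, ![-1, -1], ![0, -1]),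
   (5, 12, ![0, -2], ![0, -1]), (6, 5, ![-1, -1], ![0, -1]), (6, 7, ![-1, 0], ![0, -1]), (6, 0, ![-1, -1], ![-1, 0]),
   (7, 8, ![-1, 0], ![0, 0]), (7, 6, ![-1, 0], ![0, -1]), (7, 14, ![0, -1], ![0, 0]), (8, 7, ![-1, 0], ![0, 0]),
   (8, 9, ![-1, 1], ![0, 0]), (8, 2, ![-1, 0], ![-1, 1]), (9, 10, ![-1, 1], ![0, 1]), (9, 8, ![-1, 1], ![0, 0]),
   (9, 16, ![0, 0], ![0, 1]), (10, 9, ![-1, 1], ![0, 1]), (10, 11, ![-1, 2], ![0, 1]), (10, 4, ![-1, 1], ![-1, 2]),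
   (11, 10, ![-1, 2], ![0, 1]), (11, 18, ![0, 1], ![0, 2]), (12, 13, ![0, -1], ![1, -2]), (12, 5, ![0, -2], ![0, -1]),
   (13, 14, ![0, -1], ![1, -1]), (13, 12, ![0, -1], ![1, -2]), (13, 19, ![1, -2], ![1, -1]), (14, 13, ![0, -1], ![1, -1]),
   (14, 15, ![0, 0], ![1, -1]), (14, 7, ![0, -1], ![0, 0]), (15, 16, ![0, 0], ![1, 0]), (15, 14, ![0, 0], ![1, -1]),
   (15, 21, ![1, -1], ![1, 0]), (16, 15, ![0, 0], ![1, 0]), (16, 17, ![0, 1], ![1, 0]), (16, 9, ![0, 0], ![0, 1]),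
   (17, 18, ![0, 1], ![1, 1]), (17, 16, ![0, 1], ![1, 0]), (17, 23, ![1, 0], ![1, 1]), (18, 17, ![0, 1], ![1, 1]),
   (18, 11, ![0, 1], ![0, 2]), (19, 20, ![1, -1], ![2, -2]), (19, 13, ![1, -2], ![1, -1]), (20, 21, ![1, -1], ![2, -1]),
   (20, 19, ![1, -1], ![2, -2]), (21, 20, ![1, -1], ![2, -1]), (21, 22, ![1, 0], ![2, -1]), (21, 15, ![1, -1], ![1, 0]),
   (22, 23, ![1, 0], ![2, 0]), (22, 21, ![1, 0], ![2, -1]), (23, 22, ![1, 0], ![2, 0]), (23, 17, ![1, 0], ![1, 1])]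

/-- Corner-face indices `y_0..y_4`. [folklore] -/
def cornerI : Fin 5 → ℕ := ![22, 18, 4, 1, 5]

/-- Directed H_G edges (as index pairs) whose common bond is bicoloured under `(S, r, c)`. [folklore] -/
def liveI (S : Finset (Site 2)) (r : Fin 5) (c : Bool) : List (ℕ × ℕ) :=
  (edgeTabI.filter fun e => BicolS S r c e.2.2.1 e.2.2.2).map fun e => (e.1, e.2.1)

/-- All directed H_G edges as index pairs. [folklore] -/
def allI : List (ℕ × ℕ) := edgeTabI.map fun e => (e.1, e.2.1)

/-! ### C9. Correctness of the index layer -/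

/-- `faceL` enumerates the face universe `U1` without repetition. [folklore] -/
private theorem faceL_nodup : faceL.Nodup := by decide

/-- `faceL` has 24 entries. [folklore] -/
private theorem faceL_length : faceL.length = 24 := by decide

/-- The face universe `U1` is the set of listed faces. [folklore] -/
private theorem U1_eq_faceL : U1 = faceL.toFinset := by decide

/-- Every face of `U1` is some `faceL[i]`. [folklore] -/
private theorem exists_index_of_mem_U1 {F : HexVertex} (hF : F ∈ U1) : ∃ i : Fin 24, faceL[i.val]'(by rw [faceL_length]; exact i.isLt) = F := by
  rw [U1_eq_faceL, List.mem_toFinset] at hF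
  obtain ⟨n, hn, rfl⟩ := List.getElem_of_mem hF
  exact ⟨⟨n, by rw [← faceL_length]; exact hn⟩, rfl⟩

/-- Shorthand: the `i`-th face. [folklore] -/
def fc (i : Fin 24) : HexVertex := faceL[i.val]'(by rw [faceL_length]; exact i.isLt)

/-- Listed faces lie in `U1`. [folklore] -/
private theorem fc_mem_U1 (i : Fin 24) : fc i ∈ U1 := by
  rw [U1_eq_faceL, List.mem_toFinset]; exact List.getElem_mem _

/-- `fc` is injective (`faceL` has no duplicates). [folklore] -/
private theorem fc_injective : Function.Injective fc := by
  intro i j h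
  have := (List.Nodup.getElem_inj_iff faceL_nodup).1 h
  exact Fin.ext this

/-- The corner faces are `fc (cornerI j)`. [cite: BollobasRiordan2006, Ch. 7 §7.2.2 pp. 168–171] -/
theorem cornerT_eq_fc : ∀ j : Fin 5, ∃ h : cornerI j < 24, cornerT j = fc ⟨cornerI j, h⟩ := by decide

/-- Table correctness: every entry of `edgeTabI` is an `H_G` edge of `hexBall1Five` between faces of `U1`, with the recorded
common bond, which has a site in `G`. [cite: BollobasRiordan2006, Ch. 7 §7.2.2 pp. 168–171] -/
theorem edgeTabI_sound : ∀ e ∈ edgeTabI, ∃ hi : e.1 < 24, ∃ hj : e.2.1 < 24,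
    hexGraph.Adj (fc ⟨e.1, hi⟩) (fc ⟨e.2.1, hj⟩) ∧ faceEdge (fc ⟨e.1, hi⟩) (fc ⟨e.2.1, hj⟩) = {e.2.2.1, e.2.2.2} ∧
      (e.2.2.1 ∈ triBall 1 ∨ e.2.2.2 ∈ triBall 1) := by
  unfold fc; decide

/-- Table completeness: every `H_G` step between faces of `U1` is listed. [cite: BollobasRiordan2006, Ch. 7 §7.2.2 pp. 168–171] -/
theorem edgeTabI_complete : ∀ i j : Fin 24, HStepS (fc i) (fc j) → ∃ e ∈ edgeTabI, e.1 = i.val ∧ e.2.1 = j.val := by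
  unfold fc HStepS; decide

/-- `BicolS` is symmetric in the two sites. [folklore] -/
private theorem bicolS_symm (S : Finset (Site 2)) (r : Fin 5) (c : Bool) (u v : Site 2) :
    BicolS S r c u v ↔ BicolS S r c v u := by
  unfold BicolS
  constructor
  · rintro (⟨hu, hv, h⟩ | ⟨hu, hv, h⟩ | ⟨hv, hu, h⟩)
    · exact Or.inl ⟨hv, hu, ⟨fun hv' hu' => (h.1 hu') hv', fun hu' => by_contra fun hv' => hu' (h.2 hv')⟩⟩
    · exact Or.inr (Or.inr ⟨hu, hv, h⟩)
    · exact Or.inr (Or.inl ⟨hv, hu, h⟩)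
  · rintro (⟨hv, hu, h⟩ | ⟨hv, hu, h⟩ | ⟨hu, hv, h⟩)
    · exact Or.inl ⟨hu, hv, ⟨fun hu' hv' => (h.1 hv') hu', fun hv' => by_contra fun hu' => hv' (h.2 hu')⟩⟩
    · exact Or.inr (Or.inr ⟨hv, hu, h⟩)
    · exact Or.inr (Or.inl ⟨hu, hv, h⟩)

/-- From `{a, b} = {u, v}`, a symmetric predicate transfers. [folklore] -/
private theorem pair_transfer {P : Site 2 → Site 2 → Prop} (hsymm : ∀ a b, P a b → P b a) {a b u v : Site 2}
    (h : ({a, b} : Finset (Site 2)) = {u, v}) (hab : P a b) : P u v := by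
  have hu : u = a ∨ u = b := by
    have : u ∈ ({a, b} : Finset (Site 2)) := by rw [h]; simp
    simpa using this
  have hv : v = a ∨ v = b := by
    have : v ∈ ({a, b} : Finset (Site 2)) := by rw [h]; simp
    simpa using this
  have ha : a = u ∨ a = v := by
    have : a ∈ ({u, v} : Finset (Site 2)) := by rw [← h]; simp
    simpa using this
  have hb : b = u ∨ b = v := by
    have : b ∈ ({u, v} : Finset (Site 2)) := by rw [← h]; simp
    simpa using this
  rcases hu with rfl | rfl <;> rcases hv with rfl | rfl
  · rcases hb with rfl | rfl <;> exact hab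
  · exact hab
  · exact hsymm _ _ hab
  · rcases ha with rfl | rfl <;> exact hab

/-- **Step equivalence**: `IStepS` between listed faces is membership of the index pair in the live-edge list. [cite: BollobasRiordan2006, Ch. 7 §7.2.2 pp. 168–171] -/
theorem iStepS_fc_iff (S : Finset (Site 2)) (r : Fin 5) (c : Bool) (i j : Fin 24) :
    IStepS S r c (fc i) (fc j) ↔ (i.val, j.val) ∈ liveI S r c := by
  constructor
  · rintro ⟨hadj, u, hu, v, hv, hfe, hb⟩
    have hG : u ∈ triBall 1 ∨ v ∈ triBall 1 := by
      rcases hb with h | h | h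
      · exact Or.inl h.1
      · exact Or.inl h.1
      · exact Or.inr h.1
    have hH : HStepS (fc i) (fc j) := by
      rcases hG with h | h
      · exact ⟨hadj, u, hu, h⟩
      · exact ⟨hadj, v, hv, h⟩
    obtain ⟨e, he, hei, hej⟩ := edgeTabI_complete i j hH
    obtain ⟨hi, hj, -, hfe', -⟩ := edgeTabI_sound e he
    have efi : fc ⟨e.1, hi⟩ = fc i := by congr 1; exact Fin.ext hei
    have efj : fc ⟨e.2.1, hj⟩ = fc j := by congr 1; exact Fin.ext hej
    rw [efi, efj, hfe] at hfe'
    have hb' : BicolS S r c e.2.2.1 e.2.2.2 := pair_transfer (fun a b h => (bicolS_symm S r c a b).1 h) hfe' hb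
    unfold liveI
    rw [List.mem_map]
    exact ⟨e, List.mem_filter.2 ⟨he, by simpa using hb'⟩, by simp [hei, hej]⟩
  · intro h
    unfold liveI at h
    rw [List.mem_map] at h
    obtain ⟨e, he, hpair⟩ := h
    rw [List.mem_filter] at he
    obtain ⟨he, hb⟩ := he
    simp only [decide_eq_true_eq] at hb
    simp only [Prod.mk.injEq] at hpair
    obtain ⟨hi, hj, hadj, hfe, -⟩ := edgeTabI_sound e he
    have efi : fc ⟨e.1, hi⟩ = fc i := by congr 1; exact Fin.ext hpair.1
    have efj : fc ⟨e.2.1, hj⟩ = fc j := by congr 1; exact Fin.ext hpair.2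
    rw [efi, efj] at hadj hfe
    refine ⟨hadj, e.2.2.1, ?_, e.2.2.2, ?_, hfe, hb⟩
    · rw [hfe]; exact mem_insert_self _ _
    · rw [hfe]; exact mem_insert_of_mem (mem_singleton_self _)

/-! ### C10. Index closures: soundness, closedness, and the equivalences with `InInterface` / `Joined` -/

/-- The step relation of an edge list. [folklore] -/
private def stepE (E : List (ℕ × ℕ)) (i j : ℕ) : Prop := (i, j) ∈ E

/-- Closedness of an index set under an edge list (decidable). [folklore] -/
private def closedI (E : List (ℕ × ℕ)) (C : List ℕ) : Prop := ∀ e ∈ E, e.1 ∈ C → e.2 ∈ C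

/-- Closedness of an index set under an edge list is decidable. [folklore] -/
instance (E : List (ℕ × ℕ)) (C : List ℕ) : Decidable (closedI E C) := by
  unfold closedI; infer_instance

/-- Live edges join listed faces. [folklore] -/
private theorem liveI_lt {S : Finset (Site 2)} {r : Fin 5} {c : Bool} {a b : ℕ} (h : (a, b) ∈ liveI S r c) : a < 24 ∧ b < 24 := by
  unfold liveI at h
  rw [List.mem_map] at h
  obtain ⟨e, he, hpair⟩ := h
  rw [List.mem_filter] at he
  obtain ⟨hi, hj, -⟩ := edgeTabI_sound e he.1
  simp only [Prod.mk.injEq] at hpair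
  exact ⟨hpair.1 ▸ hi, hpair.2 ▸ hj⟩

/-- All listed edges join listed faces and are `H_G` steps. [folklore] -/
private theorem allI_spec {a b : ℕ} (h : (a, b) ∈ allI) : ∃ ha : a < 24, ∃ hb : b < 24, HStepS (fc ⟨a, ha⟩) (fc ⟨b, hb⟩) := by
  unfold allI at h
  rw [List.mem_map] at h
  obtain ⟨e, he, hpair⟩ := h
  obtain ⟨hi, hj, hadj, hfe, hG⟩ := edgeTabI_sound e he
  simp only [Prod.mk.injEq] at hpair
  obtain ⟨rfl, rfl⟩ := hpair
  refine ⟨hi, hj, hadj, ?_⟩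
  rcases hG with hG | hG
  · exact ⟨e.2.2.1, by rw [hfe]; exact mem_insert_self _ _, hG⟩
  · exact ⟨e.2.2.2, by rw [hfe]; exact mem_insert_of_mem (mem_singleton_self _), hG⟩

/-- Conversely every `H_G` step between listed faces is in `allI`. [folklore] -/
private theorem mem_allI_of_hStepS {i j : Fin 24} (h : HStepS (fc i) (fc j)) : (i.val, j.val) ∈ allI := by
  obtain ⟨e, he, hei, hej⟩ := edgeTabI_complete i j h
  unfold allI
  rw [List.mem_map]
  exact ⟨e, he, by simp [hei, hej]⟩

/-- The `H_G`-edges off an index set `IP`. [folklore] -/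
def offI (IP : List ℕ) : List (ℕ × ℕ) := allI.filter fun e => e.1 ∉ IP ∧ e.2 ∉ IP

/-! ### C11. Local events: `DeterminedBy` for the mid-edge event, and the counting bridge -/

/-- `Bicol` depends on the configuration only through the sites of `G`. [folklore] -/
private theorem bicol_congr_imp (D : TriMarkedDomain 5) {σ σ' : SiteConfig (Site 2)} (h : ∀ s ∈ D.verts, (s ∈ σ ↔ s ∈ σ'))
    (r : Fin 5) (c : Bool) (u v : Site 2) (hb : Bicol D σ r c u v) : Bicol D σ' r c u v := by
  unfold Bicol at hb ⊢
  rcases hb with ⟨hu, hv, h1⟩ | ⟨hu, hv, h1⟩ | ⟨hv, hu, h1⟩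
  · exact Or.inl ⟨hu, hv, by rw [← h u hu, ← h v hv]; exact h1⟩
  · exact Or.inr (Or.inl ⟨hu, hv, by rw [← h u hu]; exact h1⟩)
  · exact Or.inr (Or.inr ⟨hv, hu, by rw [← h _ hv]; exact h1⟩)

/-- `Bicol` under two configurations agreeing on `G`. [cite: KhristoforovSmirnov2021, §1.2 (colourings ↔ loop configurations, pp. 3–4)] -/
theorem bicol_congr (D : TriMarkedDomain 5) {σ σ' : SiteConfig (Site 2)} (h : ∀ s ∈ D.verts, (s ∈ σ ↔ s ∈ σ'))
    (r : Fin 5) (c : Bool) (u v : Site 2) : Bicol D σ r c u v ↔ Bicol D σ' r c u v :=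
  ⟨bicol_congr_imp D h r c u v, bicol_congr_imp D (fun s hs => (h s hs).symm) r c u v⟩

/-- `IStep` depends on the configuration only through the sites of `G`. [cite: KhristoforovSmirnov2021, §1.2 (colourings ↔ loop configurations, pp. 3–4)] -/
theorem iStep_congr_eq (D : TriMarkedDomain 5) {σ σ' : SiteConfig (Site 2)} (h : ∀ s ∈ D.verts, (s ∈ σ ↔ s ∈ σ'))
    (r : Fin 5) (c : Bool) : IStep D σ r c = IStep D σ' r c := by
  funext F F'
  apply propext
  unfold IStep
  constructor
  · rintro ⟨hadj, u, v, hfe, hb⟩; exact ⟨hadj, u, v, hfe, (bicol_congr D h r c u v).1 hb⟩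
  · rintro ⟨hadj, u, v, hfe, hb⟩; exact ⟨hadj, u, v, hfe, (bicol_congr D h r c u v).2 hb⟩

/-- `InInterface` depends on the configuration only through the sites of `G`. [cite: KhristoforovSmirnov2021, §1.2 (colourings ↔ loop configurations, pp. 3–4)] -/
theorem inInterface_congr_eq (D : TriMarkedDomain 5) {σ σ' : SiteConfig (Site 2)} (h : ∀ s ∈ D.verts, (s ∈ σ ↔ s ∈ σ'))
    (r : Fin 5) (c : Bool) : InInterface D σ r c = InInterface D σ' r c := by
  funext F
  unfold InInterface
  rw [iStep_congr_eq D h r c]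

/-- `Joined` depends on the configuration only through the sites of `G`. [cite: KhristoforovSmirnov2021, §1.2 (colourings ↔ loop configurations, pp. 3–4)] -/
theorem joined_congr (D : TriMarkedDomain 5) {σ σ' : SiteConfig (Site 2)} (h : ∀ s ∈ D.verts, (s ∈ σ ↔ s ∈ σ'))
    (r : Fin 5) (c : Bool) (x : HexVertex) : Joined D σ r c x ↔ Joined D σ' r c x := by
  unfold Joined
  rw [inInterface_congr_eq D h r c]

/-! ### C12. Self-certifying closures (a convergence flag instead of an external closedness check) -/

/-- The new targets reachable in one step from `R` along `E` and not yet in `R`. [folklore] -/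
def newI (E : List (ℕ × ℕ)) (R : List ℕ) : List ℕ :=
  ((E.filter fun e => e.1 ∈ R ∧ e.2 ∉ R).map fun e => e.2).dedup

/-- Closure with fuel: expand until a round adds nothing (flag `true`) or the fuel runs out (flag `false`). [folklore] -/
def closeF (E : List (ℕ × ℕ)) : ℕ → List ℕ → List ℕ × Bool
  | 0, R => (R, false)
  | n + 1, R =>
    let nw := newI E R
    if nw = [] then (R, true) else closeF E n (R ++ nw)

/-- The source lies in the closure. [folklore] -/
private theorem closeF_subset (E : List (ℕ × ℕ)) : ∀ (n : ℕ) (R : List ℕ), ∀ i ∈ R, i ∈ (closeF E n R).1 := by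
  intro n
  induction n with
  | zero => intro R i hi; exact hi
  | succ n ih =>
    intro R i hi
    unfold closeF
    dsimp only
    split
    · exact hi
    · exact ih _ i (List.mem_append.2 (Or.inl hi))

/-- Everything in the closure is reachable from the source along `E`. [folklore] -/
private theorem closeF_sound (E : List (ℕ × ℕ)) : ∀ (n : ℕ) (R : List ℕ) {j : ℕ}, j ∈ (closeF E n R).1 →
    ∃ i ∈ R, Relation.ReflTransGen (stepE E) i j := by
  intro n
  induction n with
  | zero => intro R j hj; exact ⟨j, hj, Relation.ReflTransGen.refl⟩
  | succ n ih =>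
    intro R j hj
    unfold closeF at hj
    dsimp only at hj
    split at hj
    · exact ⟨j, hj, Relation.ReflTransGen.refl⟩
    · obtain ⟨i, hi, hreach⟩ := ih _ hj
      rcases List.mem_append.1 hi with h | h
      · exact ⟨i, h, hreach⟩
      · unfold newI at h
        rw [List.mem_dedup, List.mem_map] at h
        obtain ⟨e, he, rfl⟩ := h
        rw [List.mem_filter] at he
        obtain ⟨heE, hcond⟩ := he
        simp only [decide_eq_true_eq] at hcond
        exact ⟨e.1, hcond.1, Relation.ReflTransGen.head (by unfold stepE; exact heE) hreach⟩

/-- If the convergence flag is set, the closure is closed under `E`. [folklore] -/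
private theorem closeF_closed (E : List (ℕ × ℕ)) : ∀ (n : ℕ) (R : List ℕ), (closeF E n R).2 = true → closedI E (closeF E n R).1 := by
  intro n
  induction n with
  | zero => intro R h; unfold closeF at h; exact absurd h (by simp)
  | succ n ih =>
    intro R h
    unfold closeF at h ⊢
    dsimp only at h ⊢
    split
    · rename_i hnil
      intro e he h1
      by_contra h2
      have : e.2 ∈ newI E R := by
        unfold newI
        rw [List.mem_dedup, List.mem_map]
        exact ⟨e, List.mem_filter.2 ⟨he, by simp [h1, h2]⟩, rfl⟩
      rw [hnil] at this
      exact absurd this (by simp)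
    · rename_i hne
      rw [if_neg hne] at h
      exact ih _ h

/-- The interface part with its convergence flag. [folklore] -/
def IPF (S : Finset (Site 2)) (r : Fin 5) (c : Bool) : List ℕ × Bool :=
  closeF (liveI S r c) 26 (((List.finRange 5).filter fun j => j ≠ r).map fun j => cornerI j)

/-- The joined set (off `IP`) with its convergence flag. [folklore] -/
def JF (IP : List ℕ) (r : Fin 5) : List ℕ × Bool := closeF (offI IP) 26 [cornerI r]

/-- **`InInterface` on listed faces = membership in `IPF`** (given the convergence flag). [cite: BollobasRiordan2006, Ch. 7 §7.2.2 pp. 168–171] -/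
theorem inInterface_fc_iffF (S : Finset (Site 2)) (r : Fin 5) (c : Bool) (hflag : (IPF S r c).2 = true)
    (i : Fin 24) : InInterface hexBall1Five (↑S) r c (fc i) ↔ i.val ∈ (IPF S r c).1 := by
  have hcl : closedI (liveI S r c) (IPF S r c).1 := closeF_closed _ _ _ hflag
  constructor
  · rintro ⟨j, hj, Y, hY, hreach⟩
    rw [isCornerFace_iff] at hY
    subst hY
    obtain ⟨hcj, hYfc⟩ := cornerT_eq_fc j
    rw [iStep_eq_S, hYfc] at hreach
    have key : ∀ F, Relation.ReflTransGen (IStepS S r c) (fc ⟨cornerI j, hcj⟩) F →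
        ∃ k : Fin 24, fc k = F ∧ k.val ∈ (IPF S r c).1 := by
      intro F hF
      induction hF with
      | refl =>
        refine ⟨⟨cornerI j, hcj⟩, rfl, ?_⟩
        apply closeF_subset
        rw [List.mem_map]
        exact ⟨j, List.mem_filter.2 ⟨List.mem_finRange j, by simpa using hj⟩, rfl⟩
      | tail _ hst ih =>
        obtain ⟨k, hk, hkC⟩ := ih
        subst hk
        have hU := (IStep.mem_facesOf hexBall1Five ((iStep_iff_S S r c _ _).2 hst)).2
        obtain ⟨k', hk'⟩ := exists_index_of_mem_U1 (by simpa [U1] using hU)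
        refine ⟨k', hk', ?_⟩
        have hst' : IStepS S r c (fc k) (fc k') := by rw [show fc k' = _ from hk']; exact hst
        exact hcl _ ((iStepS_fc_iff S r c k k').1 hst') hkC
    obtain ⟨k, hk, hkC⟩ := key _ hreach
    rw [← fc_injective hk]
    exact hkC
  · intro hi
    obtain ⟨s, hs, hreach⟩ := closeF_sound _ _ _ hi
    rw [List.mem_map] at hs
    obtain ⟨j, hj, rfl⟩ := hs
    rw [List.mem_filter] at hj
    have hjr : j ≠ r := by simpa using hj.2
    obtain ⟨hcj, hYfc⟩ := cornerT_eq_fc j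
    have key : ∀ n, Relation.ReflTransGen (stepE (liveI S r c)) (cornerI j) n →
        ∃ k : Fin 24, k.val = n ∧ Relation.ReflTransGen (IStepS S r c) (fc ⟨cornerI j, hcj⟩) (fc k) := by
      intro n hn
      induction hn with
      | refl => exact ⟨⟨cornerI j, hcj⟩, rfl, Relation.ReflTransGen.refl⟩
      | tail _ hst ih =>
        obtain ⟨k, hk, hreach'⟩ := ih
        unfold stepE at hst
        obtain ⟨ha, hb⟩ := liveI_lt hst
        refine ⟨⟨_, hb⟩, rfl, hreach'.tail ?_⟩
        have e : k = ⟨_, ha⟩ := Fin.ext hk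
        subst e
        exact (iStepS_fc_iff S r c _ _).2 hst
    obtain ⟨k, hk, hreach'⟩ := key _ hreach
    have e : k = i := Fin.ext hk
    subst e
    refine ⟨j, hjr, cornerT j, (isCornerFace_iff j _).2 rfl, ?_⟩
    rw [iStep_eq_S, hYfc]
    exact hreach'

/-- **`Joined` on listed faces = the index event via `JF`** (given both convergence flags). [cite: BollobasRiordan2006, Ch. 7 §7.2.2 pp. 168–171] -/
theorem joined_fc_iffF (S : Finset (Site 2)) (r : Fin 5) (c : Bool) (hflagI : (IPF S r c).2 = true)
    {IP : List ℕ} (hIP : (IPF S r c).1 = IP) (hflagJ : (JF IP r).2 = true) (i : Fin 24) :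
    Joined hexBall1Five (↑S) r c (fc i) ↔ cornerI r ∉ IP ∧ i.val ∈ (JF IP r).1 := by
  obtain ⟨hcr, hYfc⟩ := cornerT_eq_fc r
  have hclJ : closedI (offI IP) (JF IP r).1 := closeF_closed _ _ _ hflagJ
  have hII : ∀ k : Fin 24, InInterface hexBall1Five (↑S) r c (fc k) ↔ k.val ∈ IP := fun k => by
    rw [inInterface_fc_iffF S r c hflagI k, hIP]
  constructor
  · rintro ⟨hxI, Y, hY, hYI, hreach⟩
    rw [isCornerFace_iff] at hY
    subst hY
    rw [hYfc] at hYI hreach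
    have hcrI : cornerI r ∉ IP := fun h => hYI ((hII ⟨cornerI r, hcr⟩).2 h)
    refine ⟨hcrI, ?_⟩
    have key : ∀ F, Relation.ReflTransGen (fun F F' => HStep hexBall1Five F F' ∧ ¬ InInterface hexBall1Five (↑S) r c F ∧
        ¬ InInterface hexBall1Five (↑S) r c F') (fc ⟨cornerI r, hcr⟩) F → ∃ k : Fin 24, fc k = F ∧ k.val ∈ (JF IP r).1 := by
      intro F hF
      induction hF with
      | refl => exact ⟨⟨cornerI r, hcr⟩, rfl, closeF_subset _ _ _ _ (List.mem_singleton.2 rfl)⟩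
      | tail _ hst ih =>
        obtain ⟨k, hk, hkJ⟩ := ih
        subst hk
        obtain ⟨hH, hn0, hn1⟩ := hst
        have hU := (HStep.mem_facesOf hexBall1Five hH).2
        obtain ⟨k', hk'⟩ := exists_index_of_mem_U1 (by simpa [U1] using hU)
        refine ⟨k', hk', ?_⟩
        rw [← hk'] at hH hn1
        have hedge : (k.val, k'.val) ∈ offI IP := by
          unfold offI
          rw [List.mem_filter]
          refine ⟨mem_allI_of_hStepS ((hStep_iff_S _ _).1 hH), ?_⟩
          simpa using And.intro (fun h => hn0 ((hII k).2 h)) (fun h => hn1 ((hII k').2 h))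
        exact hclJ _ hedge hkJ
    obtain ⟨k, hk, hkJ⟩ := key _ hreach
    rw [← fc_injective hk]
    exact hkJ
  · rintro ⟨hcrI, hi⟩
    obtain ⟨s, hs, hreach⟩ := closeF_sound _ _ _ hi
    rw [List.mem_singleton] at hs
    subst hs
    have key : ∀ n, Relation.ReflTransGen (stepE (offI IP)) (cornerI r) n →
        ∃ k : Fin 24, k.val = n ∧ k.val ∉ IP ∧ Relation.ReflTransGen (fun F F' => HStep hexBall1Five F F' ∧
          ¬ InInterface hexBall1Five (↑S) r c F ∧ ¬ InInterface hexBall1Five (↑S) r c F') (fc ⟨cornerI r, hcr⟩) (fc k) := by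
      intro n hn
      induction hn with
      | refl => exact ⟨⟨cornerI r, hcr⟩, rfl, hcrI, Relation.ReflTransGen.refl⟩
      | tail _ hst ih =>
        obtain ⟨k, hk, -, hreach'⟩ := ih
        unfold stepE offI at hst
        rw [List.mem_filter] at hst
        obtain ⟨hall, hoff⟩ := hst
        simp only [decide_eq_true_eq] at hoff
        obtain ⟨ha, hb, hH⟩ := allI_spec hall
        have e : k = ⟨_, ha⟩ := Fin.ext hk
        subst e
        refine ⟨⟨_, hb⟩, rfl, hoff.2, hreach'.tail ⟨(hStep_iff_S _ _).2 hH, ?_, ?_⟩⟩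
        · exact fun h => hoff.1 ((hII _).1 h)
        · exact fun h => hoff.2 ((hII ⟨_, hb⟩).1 h)
    obtain ⟨k, hk, hkI, hreach'⟩ := key _ hreach
    have e : k = i := Fin.ext hk
    subst e
    refine ⟨fun h => hkI ((hII k).1 h), cornerT r, (isCornerFace_iff r _).2 rfl, ?_, ?_⟩
    · rw [hYfc]; exact fun h => hcrI ((hII _).1 h)
    · rw [hYfc]; exact hreach'

/-! ### C13. The self-certifying indicator and the count theorems -/

/-- If `y_r` lies on the interface part, no face is joined. [cite: KhristoforovSmirnov2021, §1.2 (colourings ↔ loop configurations, pp. 3–4)] -/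
theorem not_joined_of_corner_mem (S : Finset (Site 2)) (r : Fin 5) (c : Bool) (hflag : (IPF S r c).2 = true)
    (hcr : cornerI r ∈ (IPF S r c).1) (x : HexVertex) : ¬ Joined hexBall1Five (↑S) r c x := by
  rintro ⟨-, Y, hY, hYI, -⟩
  rw [isCornerFace_iff] at hY
  subst hY
  obtain ⟨hcr', hYfc⟩ := cornerT_eq_fc r
  rw [hYfc, inInterface_fc_iffF S r c hflag] at hYI
  exact hYI hcr


/-! ## Part H — the holomorphicity witness (b-step0 gen 9) -/

/-! ### H1. The match closure (link patterns `A`/`B` on indices) -/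

/-- The `IStep`-closure of the corner face `y_{r+1}` (indices), with its convergence flag. [folklore] -/
def MF (S : Finset (Site 2)) (r : Fin 5) (c : Bool) : List ℕ × Bool := closeF (liveI S r c) 26 [cornerI (r + 1)]

/-- **Linking on listed corners = membership in `MF`** (given the convergence flag): the corner face of mark `t` is
`IStep`-linked to the corner face of mark `r + 1` iff its index lies in the closure. [cite: BollobasRiordan2006, Ch. 7 §7.2.2 pp. 168–171] -/
theorem linked_fc_iffF (S : Finset (Site 2)) (r : Fin 5) (c : Bool) (hflag : (MF S r c).2 = true) (t : Fin 5) :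
    (∃ Y₁ Y₂ : HexVertex, IsCornerFace hexBall1Five (r + 1) Y₁ ∧ IsCornerFace hexBall1Five t Y₂ ∧
      Relation.ReflTransGen (IStep hexBall1Five (↑S) r c) Y₁ Y₂) ↔ cornerI t ∈ (MF S r c).1 := by
  have hcl : closedI (liveI S r c) (MF S r c).1 := closeF_closed _ _ _ hflag
  obtain ⟨hc1, hY1fc⟩ := cornerT_eq_fc (r + 1)
  obtain ⟨hct, hYtfc⟩ := cornerT_eq_fc t
  constructor
  · rintro ⟨Y₁, Y₂, hY₁, hY₂, hreach⟩
    rw [isCornerFace_iff] at hY₁ hY₂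
    subst hY₁; subst hY₂
    rw [iStep_eq_S, hY1fc, hYtfc] at hreach
    have key : ∀ F, Relation.ReflTransGen (IStepS S r c) (fc ⟨cornerI (r + 1), hc1⟩) F →
        ∃ k : Fin 24, fc k = F ∧ k.val ∈ (MF S r c).1 := by
      intro F hF
      induction hF with
      | refl => exact ⟨⟨cornerI (r + 1), hc1⟩, rfl, closeF_subset _ _ _ _ (List.mem_singleton.2 rfl)⟩
      | tail _ hst ih =>
        obtain ⟨k, hk, hkC⟩ := ih
        subst hk
        have hU := (IStep.mem_facesOf hexBall1Five ((iStep_iff_S S r c _ _).2 hst)).2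
        obtain ⟨k', hk'⟩ := exists_index_of_mem_U1 (by simpa [U1] using hU)
        refine ⟨k', hk', ?_⟩
        have hst' : IStepS S r c (fc k) (fc k') := by rw [show fc k' = _ from hk']; exact hst
        exact hcl _ ((iStepS_fc_iff S r c k k').1 hst') hkC
    obtain ⟨k, hk, hkC⟩ := key _ hreach
    have e : k = ⟨cornerI t, hct⟩ := fc_injective hk
    rw [e] at hkC
    exact hkC
  · intro ht
    obtain ⟨s, hs, hreach⟩ := closeF_sound _ _ _ ht
    rw [List.mem_singleton] at hs
    subst hs
    have key : ∀ n, Relation.ReflTransGen (stepE (liveI S r c)) (cornerI (r + 1)) n →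
        ∃ k : Fin 24, k.val = n ∧ Relation.ReflTransGen (IStepS S r c) (fc ⟨cornerI (r + 1), hc1⟩) (fc k) := by
      intro n hn
      induction hn with
      | refl => exact ⟨⟨cornerI (r + 1), hc1⟩, rfl, Relation.ReflTransGen.refl⟩
      | tail _ hst ih =>
        obtain ⟨k, hk, hreach'⟩ := ih
        unfold stepE at hst
        obtain ⟨ha, hb⟩ := liveI_lt hst
        refine ⟨⟨_, hb⟩, rfl, hreach'.tail ?_⟩
        have e : k = ⟨_, ha⟩ := Fin.ext hk
        subst e
        exact (iStepS_fc_iff S r c _ _).2 hst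
    obtain ⟨k, hk, hreach'⟩ := key _ hreach
    have e : k = ⟨cornerI t, hct⟩ := Fin.ext hk
    subst e
    refine ⟨cornerT (r + 1), cornerT t, (isCornerFace_iff _ _).2 rfl, (isCornerFace_iff _ _).2 rfl, ?_⟩
    rw [iStep_eq_S, hY1fc, hYtfc]
    exact hreach'

/-- `MatchA` on `hexBall1Five` = the index of `y_{r+2}` lies in the match closure. [cite: KhristoforovSmirnov2021, §1.2 Lemma 2 (p. 4)] -/
theorem matchA_fc_iffF (S : Finset (Site 2)) (r : Fin 5) (c : Bool) (hflag : (MF S r c).2 = true) :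
    MatchA hexBall1Five (↑S) r c ↔ cornerI (r + 2) ∈ (MF S r c).1 :=
  linked_fc_iffF S r c hflag (r + 2)

/-- `MatchB` on `hexBall1Five` = the index of `y_{r+4}` lies in the match closure. [cite: KhristoforovSmirnov2021, §1.2 Lemma 2 (p. 4)] -/
theorem matchB_fc_iffF (S : Finset (Site 2)) (r : Fin 5) (c : Bool) (hflag : (MF S r c).2 = true) :
    MatchB hexBall1Five (↑S) r c ↔ cornerI (r + 4) ∈ (MF S r c).1 :=
  linked_fc_iffF S r c hflag (r + 4)

/-! ### H2. The pattern event is local; `patternProb` as a count -/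

/-- `MatchA` depends on the configuration only through the sites of `G`. [cite: KhristoforovSmirnov2021, §1.2 (colourings ↔ loop configurations, pp. 3–4)] -/
theorem matchA_congr (D : TriMarkedDomain 5) {σ σ' : SiteConfig (Site 2)} (h : ∀ s ∈ D.verts, (s ∈ σ ↔ s ∈ σ'))
    (r : Fin 5) (c : Bool) : MatchA D σ r c ↔ MatchA D σ' r c := by
  unfold MatchA
  rw [iStep_congr_eq D h r c]

/-- `MatchB` depends on the configuration only through the sites of `G`. [cite: KhristoforovSmirnov2021, §1.2 (colourings ↔ loop configurations, pp. 3–4)] -/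
theorem matchB_congr (D : TriMarkedDomain 5) {σ σ' : SiteConfig (Site 2)} (h : ∀ s ∈ D.verts, (s ∈ σ ↔ s ∈ σ'))
    (r : Fin 5) (c : Bool) : MatchB D σ r c ↔ MatchB D σ' r c := by
  unfold MatchB
  rw [iStep_congr_eq D h r c]

/-- The pattern-resolved mid-edge event `{M = m} ∩ {x or x' joined to y_r}` as a predicate. [cite: KhristoforovSmirnov2021, §1.2 (colourings ↔ loop configurations, pp. 3–4)] -/
def PEvent (D : TriMarkedDomain 5) (σ : SiteConfig (Site 2)) (r : Fin 5) (c m : Bool) (x x' : HexVertex) : Prop :=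
  (if m then MatchB D σ r c else MatchA D σ r c) ∧ (Joined D σ r c x ∨ Joined D σ r c x')

/-- The pattern event as a set of configurations. [folklore] -/
def pEventSet (D : TriMarkedDomain 5) (r : Fin 5) (c m : Bool) (x x' : HexVertex) : Set (SiteConfig (Site 2)) :=
  {σ | PEvent D σ r c m x x'}

/-- The pattern event is determined by the sites of the domain. [cite: BollobasRiordan2006, Ch. 7 proof of Lemma 6 p. 175] -/
theorem pEventSet_determinedBy (D : TriMarkedDomain 5) (r : Fin 5) (c m : Bool) (x x' : HexVertex) :
    DeterminedBy (pEventSet D r c m x x') (↑D.verts : Set (Site 2)) := by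
  rw [determinedBy_iff]
  intro ω ω' hωω'
  have h : ∀ s ∈ D.verts, (s ∈ ω ↔ s ∈ ω') := fun s hs => by
    have := Set.ext_iff.1 hωω' s
    simp only [Set.mem_inter_iff, Finset.mem_coe] at this
    exact ⟨fun hω => (this.1 ⟨hω, hs⟩).1, fun hω' => (this.2 ⟨hω', hs⟩).1⟩
  show PEvent D ω r c m x x' ↔ PEvent D ω' r c m x x'
  unfold PEvent
  rw [joined_congr D h, joined_congr D h, matchA_congr D h, matchB_congr D h]

open Classical in
/-- `patternProb` as a count over the open sets `T ⊆ G`. [cite: BollobasRiordan2006, Ch. 7 proof of Lemma 6 p. 175] -/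
theorem patternProb_eq_card (D : TriMarkedDomain 5) (r : Fin 5) (c m : Bool) (x x' : HexVertex) :
    patternProb D r c m x x' =
      ((D.verts.powerset.filter fun T : Finset (Site 2) => PEvent D (↑T : Set (Site 2)) r c m x x').card : ℝ) *
        (1 / 2) ^ D.verts.card := by
  unfold patternProb triSitePercolation
  rw [show {σ : SiteConfig (Site 2) | (if m then MatchB D σ r c else MatchA D σ r c) ∧
      (Joined D σ r c x ∨ Joined D σ r c x')} = pEventSet D r c m x x' from rfl,
    sitePercolation_half_real_eq_card_powerset D.verts (pEventSet_determinedBy D r c m x x')]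
  have hf : (D.verts.powerset.filter fun T : Finset (Site 2) => (↑T : Set (Site 2)) ∈ pEventSet D r c m x x') =
      D.verts.powerset.filter fun T : Finset (Site 2) => PEvent D (↑T : Set (Site 2)) r c m x x' :=
    Finset.filter_congr fun T _ => Iff.rfl
  rw [hf]

/-! ### H3. The self-certifying triple indicator (three edges at one face share all closures) -/

/-- The pattern event between listed faces. [folklore] -/
private def pEventI (S : Finset (Site 2)) (r : Fin 5) (c m : Bool) (i j : Fin 24) : Prop :=
  PEvent hexBall1Five (↑S) r c m (fc i) (fc j)

/-- Failure triple. [folklore] -/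
def failH : ℕ × ℕ × ℕ := (1000, 1000, 1000)

/-- Self-certifying triple value for the face `fc i` and its three neighbours `fc j₀, fc j₁, fc j₂` under `(S, r, c)` and
pattern `m`: `(1000,1000,1000)` if some closure ran out of fuel, else the three 0/1 indicators of the pattern-resolved
mid-edge events at the edges `(i, j₀)`, `(i, j₁)`, `(i, j₂)` — the interface part, the match closure and the joined
set are computed ONCE. [folklore] -/
def valH (S : Finset (Site 2)) (r : Fin 5) (c m : Bool) (i j₀ j₁ j₂ : ℕ) : ℕ × ℕ × ℕ :=
  let P := IPF S r c
  let M := MF S r c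
  if P.2 = false then failH else
    if M.2 = false then failH else
      if (if m then decide (cornerI (r + 4) ∈ M.1) else decide (cornerI (r + 2) ∈ M.1)) = false then (0, 0, 0) else
        if cornerI r ∈ P.1 then (0, 0, 0) else
          let Q := JF P.1 r
          if Q.2 = false then failH else
            (if i ∈ Q.1 ∨ j₀ ∈ Q.1 then 1 else 0, if i ∈ Q.1 ∨ j₁ ∈ Q.1 then 1 else 0,
              if i ∈ Q.1 ∨ j₂ ∈ Q.1 then 1 else 0)

open Classical in
/-- The indicator triple of the three pattern events. [folklore] -/
def indH (S : Finset (Site 2)) (r : Fin 5) (c m : Bool) (i j₀ j₁ j₂ : Fin 24) : ℕ × ℕ × ℕ :=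
  (if pEventI S r c m i j₀ then 1 else 0, if pEventI S r c m i j₁ then 1 else 0, if pEventI S r c m i j₂ then 1 else 0)

open Classical in
/-- Specification of `valH`: either the failure triple, or the indicator triple. [folklore] -/
private theorem valH_spec (S : Finset (Site 2)) (r : Fin 5) (c m : Bool) (i j₀ j₁ j₂ : Fin 24) :
    valH S r c m i.val j₀.val j₁.val j₂.val = failH ∨
      valH S r c m i.val j₀.val j₁.val j₂.val = indH S r c m i j₀ j₁ j₂ := by
  by_cases hP : (IPF S r c).2 = false
  · left; unfold valH; simp [hP]
  have hP' : (IPF S r c).2 = true := by simpa using hP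
  by_cases hM : (MF S r c).2 = false
  · left; unfold valH; simp [hP, hM]
  have hM' : (MF S r c).2 = true := by simpa using hM
  -- the matching indicator
  have hmatch : ((if m then decide (cornerI (r + 4) ∈ (MF S r c).1) else decide (cornerI (r + 2) ∈ (MF S r c).1)) = true)
      ↔ (if m then MatchB hexBall1Five (↑S) r c else MatchA hexBall1Five (↑S) r c) := by
    cases m
    · simp only [Bool.false_eq_true, ↓reduceIte, decide_eq_true_eq]; exact (matchA_fc_iffF S r c hM').symm
    · simp only [↓reduceIte, decide_eq_true_eq]; exact (matchB_fc_iffF S r c hM').symm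
  by_cases hmt : (if m then decide (cornerI (r + 4) ∈ (MF S r c).1) else decide (cornerI (r + 2) ∈ (MF S r c).1)) = false
  · -- pattern is not `m`: all three events fail
    right
    have hnm : ¬ (if m then MatchB hexBall1Five (↑S) r c else MatchA hexBall1Five (↑S) r c) := by
      intro h; have := hmatch.2 h; rw [hmt] at this; exact Bool.false_ne_true this
    have h0 : ¬ pEventI S r c m i j₀ := fun h => hnm h.1
    have h1 : ¬ pEventI S r c m i j₁ := fun h => hnm h.1
    have h2 : ¬ pEventI S r c m i j₂ := fun h => hnm h.1
    unfold valH indH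
    simp [hP, hM, hmt, h0, h1, h2]
  have hmt' : (if m then decide (cornerI (r + 4) ∈ (MF S r c).1) else decide (cornerI (r + 2) ∈ (MF S r c).1)) = true := by
    rwa [Bool.not_eq_false] at hmt
  have hym : (if m then MatchB hexBall1Five (↑S) r c else MatchA hexBall1Five (↑S) r c) := hmatch.1 hmt'
  by_cases hcr : cornerI r ∈ (IPF S r c).1
  · right
    have hnj : ∀ k : Fin 24, ¬ Joined hexBall1Five (↑S) r c (fc k) := fun k => not_joined_of_corner_mem S r c hP' hcr _
    have h0 : ¬ pEventI S r c m i j₀ := fun h => h.2.elim (hnj i) (hnj j₀)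
    have h1 : ¬ pEventI S r c m i j₁ := fun h => h.2.elim (hnj i) (hnj j₁)
    have h2 : ¬ pEventI S r c m i j₂ := fun h => h.2.elim (hnj i) (hnj j₂)
    unfold valH indH
    simp [hP, hM, hmt', hcr, h0, h1, h2]
  by_cases hQ : (JF (IPF S r c).1 r).2 = false
  · left; unfold valH; simp [hP, hM, hmt', hcr, hQ]
  have hQ' : (JF (IPF S r c).1 r).2 = true := by simpa using hQ
  right
  have hJ : ∀ k : Fin 24, Joined hexBall1Five (↑S) r c (fc k) ↔ k.val ∈ (JF (IPF S r c).1 r).1 := fun k => by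
    rw [joined_fc_iffF S r c hP' rfl hQ' k]
    exact ⟨fun h => h.2, fun h => ⟨hcr, h⟩⟩
  have hev : ∀ k : Fin 24, (i.val ∈ (JF (IPF S r c).1 r).1 ∨ k.val ∈ (JF (IPF S r c).1 r).1) ↔ pEventI S r c m i k := by
    intro k
    unfold pEventI PEvent
    rw [hJ i, hJ k]
    exact ⟨fun h => ⟨hym, h⟩, fun h => h.2⟩
  have key : ∀ k : Fin 24, (if (i.val ∈ (JF (IPF S r c).1 r).1 ∨ k.val ∈ (JF (IPF S r c).1 r).1) then (1 : ℕ) else 0)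
      = (if pEventI S r c m i k then 1 else 0) := fun k => if_congr (hev k) rfl rfl
  unfold valH indH
  simp only [hP', hM', hmt', hcr, hQ', Bool.true_eq_false, ↓reduceIte, key]

open Classical in
/-- From the kernel sum of `valH` (a triple with entries `< 1000`) to the three counts of the pattern events.
[folklore] -/
private theorem counts_of_sumH (r : Fin 5) (c m : Bool) (i j₀ j₁ j₂ : Fin 24) {n₀ n₁ n₂ : ℕ}
    (hn₀ : n₀ < 1000)
    (hsum : ∑ S ∈ (triBall 1).powerset, valH S r c m i.val j₀.val j₁.val j₂.val = (n₀, n₁, n₂)) :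
    ((triBall 1).powerset.filter fun S => pEventI S r c m i j₀).card = n₀ ∧
    ((triBall 1).powerset.filter fun S => pEventI S r c m i j₁).card = n₁ ∧
    ((triBall 1).powerset.filter fun S => pEventI S r c m i j₂).card = n₂ := by
  have hval : ∀ S ∈ (triBall 1).powerset, valH S r c m i.val j₀.val j₁.val j₂.val = indH S r c m i j₀ j₁ j₂ := by
    intro S hS
    rcases valH_spec S r c m i j₀ j₁ j₂ with h | h
    · exfalso
      have hle : (valH S r c m i.val j₀.val j₁.val j₂.val).1 ≤
          (∑ T ∈ (triBall 1).powerset, valH T r c m i.val j₀.val j₁.val j₂.val).1 := by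
        rw [Prod.fst_sum]
        exact Finset.single_le_sum (f := fun T => (valH T r c m i.val j₀.val j₁.val j₂.val).1)
          (fun _ _ => Nat.zero_le _) hS
      rw [hsum, h] at hle
      unfold failH at hle
      simp only at hle
      omega
    · exact h
  have hs : ∑ S ∈ (triBall 1).powerset, indH S r c m i j₀ j₁ j₂ = (n₀, n₁, n₂) := by
    rw [← hsum]; exact (Finset.sum_congr rfl hval).symm
  have e0 := congrArg Prod.fst hs
  have e1 := congrArg (fun p => p.2.1) hs
  have e2 := congrArg (fun p => p.2.2) hs
  simp only [Prod.fst_sum, Prod.snd_sum] at e0 e1 e2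
  unfold indH at e0 e1 e2
  simp only at e0 e1 e2
  refine ⟨?_, ?_, ?_⟩
  · rw [Finset.card_filter]; exact e0
  · rw [Finset.card_filter]; exact e1
  · rw [Finset.card_filter]; exact e2

open Classical in
/-- `patternProb` on `hexBall1Five` between listed faces, from a count. [cite: BollobasRiordan2006, Ch. 7 proof of Lemma 6 p. 175] -/
theorem patternProb_fc_eq (r : Fin 5) (c m : Bool) (i j : Fin 24) {n : ℕ}
    (hcount : ((triBall 1).powerset.filter fun S => pEventI S r c m i j).card = n) :
    patternProb hexBall1Five r c m (fc i) (fc j) = (n : ℝ) / 128 := by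
  have hcard : (triBall 1).card = 7 := by decide
  rw [patternProb_eq_card, hexBall1Five_verts, hcard]
  have hf : ((triBall 1).powerset.filter fun T : Finset (Site 2) =>
      PEvent hexBall1Five (↑T : Set (Site 2)) r c m (fc i) (fc j)) = (triBall 1).powerset.filter fun S => pEventI S r c m i j :=
    Finset.filter_congr fun T _ => Iff.rfl
  rw [hf, hcount]
  ring

/-! ### H4. The cube root of unity `τ` -/

/-- `τ` is a primitive cube root of unity. [folklore] -/
private theorem isPrimitiveRoot_tau : IsPrimitiveRoot tau 3 := by
  have h := Complex.isPrimitiveRoot_exp 3 (by norm_num)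
  unfold tau
  convert h using 2
  push_cast
  ring

/-- `τ² + τ + 1 = 0`. [folklore] -/
private theorem tau_sq_add_tau_add_one : tau ^ 2 + tau + 1 = 0 := by
  have h := isPrimitiveRoot_tau.geom_sum_eq_zero (by norm_num : 1 < 3)
  simp only [Finset.sum_range_succ, Finset.sum_range_zero, pow_zero, pow_one, zero_add] at h
  linear_combination h

/-! ### H5. KERNEL: the three triple sums at the centre face `(0,0)▵` (faces 16; neighbours 15, 17, 9) -/

set_option maxHeartbeats 400000000 in
/-- Pattern `A`, reference `r = 0`, colour `false`: counts `34, 33, 25` of `128` at the three edges. [folklore] -/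
private theorem sumH_centre_r0A : ∑ S ∈ (triBall 1).powerset, valH S 0 false false 16 15 17 9 = (34, 33, 25) := by
  decide +kernel

set_option maxHeartbeats 400000000 in
/-- Pattern `B`, reference `r = 1`, colour `false`: counts `6, 15, 8` of `128`. [folklore] -/
private theorem sumH_centre_r1B : ∑ S ∈ (triBall 1).powerset, valH S 1 false true 16 15 17 9 = (6, 15, 8) := by
  decide +kernel

set_option maxHeartbeats 400000000 in
/-- Pattern `B`, reference `r = 4`, colour `false`: counts `6, 0, 0` of `128`. [folklore] -/
private theorem sumH_centre_r4B : ∑ S ∈ (triBall 1).powerset, valH S 4 false true 16 15 17 9 = (6, 0, 0) := by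
  decide +kernel

/-- Face bookkeeping: `fc 16 = (0,0)▵`. [folklore] -/
private theorem fc16 : fc 16 = (![0, 0], 0) := by decide
/-- Face bookkeeping: `fc 15 = (0,-1)▿`. [folklore] -/
private theorem fc15 : fc 15 = (![0, -1], 1) := by decide
/-- Face bookkeeping: `fc 17 = (0,0)▿`. [folklore] -/
private theorem fc17 : fc 17 = (![0, 0], 1) := by decide
/-- Face bookkeeping: `fc 9 = (-1,0)▿`. [folklore] -/
private theorem fc9 : fc 9 = (![-1, 0], 1) := by decide

/-- The three counter-clockwise neighbours of the centre face `(0,0)▵` are the listed faces `15, 17, 9`. [folklore] -/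
private theorem ccwNbr_centre : ccwNbr (![0, 0], 0) 0 = fc 15 ∧ ccwNbr (![0, 0], 0) 1 = fc 17 ∧ ccwNbr (![0, 0], 0) 2 = fc 9 := by
  rw [fc15, fc17, fc9]
  refine ⟨?_, ?_, ?_⟩ <;> decide

/-! ### H6. ★ The five-point holomorphicity relation at the centre face, in the kernel -/

/-- ★ **Five-point discrete holomorphicity (H) holds, in the kernel, on the five-marked unit hexagon at its centre face**:
for the interface-layer observables of record (`sparseObs`/`patternProb`, D1-v2 = `FiveMarkedLoops.lean`) on
`hexBall1Five`, reference `j = 0`, colour `false`, around the interior face `v = (0,0)▵` with its three neighbours in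
counter-clockwise order, `Σ_{k<3} τ^k F_0(v, ccwNbr v k) = 0` — a parafermionic-type local linear relation with
constant complex coefficients `(1, τ, τ²)`, `τ = e^{2πi/3}`, between nine pattern-resolved connection probabilities
(counts `34,33,25 | 6,15,8 | 6,0,0` of `2^7`); the identity is `(34 + 27τ + 19τ² − 15τ³ − 8τ⁴)/128 =
(τ²+τ+1)(−8τ²−7τ+34)/128 = 0`. [cite: KhristoforovSmirnov2021, §2 Definition 3 and Lemma 4 (p. 5)] -/
theorem fivePointHolomorphy_hexBall1Five_centre :
    ∑ k : Fin 3, tau ^ (k : ℕ) * sparseObs hexBall1Five 0 false (![0, 0], 0) (ccwNbr (![0, 0], 0) k) = 0 := by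
  obtain ⟨h0, h1, h2⟩ := ccwNbr_centre
  rw [Fin.sum_univ_three]
  simp only [Fin.val_zero, Fin.val_one, Fin.val_two, pow_zero, pow_one, one_mul, h0, h1, h2]
  rw [← fc16]
  -- the nine counts
  obtain ⟨a0, a1, a2⟩ := counts_of_sumH 0 false false 16 15 17 9 (by norm_num) sumH_centre_r0A
  obtain ⟨b0, b1, b2⟩ := counts_of_sumH 1 false true 16 15 17 9 (by norm_num) sumH_centre_r1B
  obtain ⟨d0, d1, d2⟩ := counts_of_sumH 4 false true 16 15 17 9 (by norm_num) sumH_centre_r4B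
  unfold sparseObs
  simp only [zero_add]
  rw [patternProb_fc_eq 0 false false 16 15 a0, patternProb_fc_eq 0 false false 16 17 a1,
    patternProb_fc_eq 0 false false 16 9 a2, patternProb_fc_eq 1 false true 16 15 b0,
    patternProb_fc_eq 1 false true 16 17 b1, patternProb_fc_eq 1 false true 16 9 b2,
    patternProb_fc_eq 4 false true 16 15 d0, patternProb_fc_eq 4 false true 16 17 d1,
    patternProb_fc_eq 4 false true 16 9 d2]
  push_cast
  linear_combination ((-8 * tau ^ 2 - 7 * tau + 34) / 128) * tau_sq_add_tau_add_one

/-- ★ **…and the relation is chiral**: with the three neighbours taken in the opposite (clockwise) cyclic order — equivalently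
with weights `(1, τ², τ)` — the same nine probabilities do NOT satisfy the relation:
`F_0(e_0) + τ² F_0(e_1) + τ F_0(e_2) = (−1 − 23τ)/128 ≠ 0`. (The lane's pilot found the mirror-oriented statement false on
every rhombus row; here it is a kernel fact on the smallest domain.) [cite: KhristoforovSmirnov2021, §2 Definition 3 and Lemma 4 (p. 5)] -/
theorem fivePointHolomorphy_hexBall1Five_centre_mirror_ne_zero :
    ∑ k : Fin 3, tau ^ (2 * (k : ℕ)) * sparseObs hexBall1Five 0 false (![0, 0], 0) (ccwNbr (![0, 0], 0) k) ≠ 0 := by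
  obtain ⟨h0, h1, h2⟩ := ccwNbr_centre
  rw [Fin.sum_univ_three]
  simp only [Fin.val_zero, Fin.val_one, Fin.val_two, mul_zero, mul_one, pow_zero, one_mul, h0, h1, h2]
  rw [← fc16]
  obtain ⟨a0, a1, a2⟩ := counts_of_sumH 0 false false 16 15 17 9 (by norm_num) sumH_centre_r0A
  obtain ⟨b0, b1, b2⟩ := counts_of_sumH 1 false true 16 15 17 9 (by norm_num) sumH_centre_r1B
  obtain ⟨d0, d1, d2⟩ := counts_of_sumH 4 false true 16 15 17 9 (by norm_num) sumH_centre_r4B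
  unfold sparseObs
  simp only [zero_add]
  rw [patternProb_fc_eq 0 false false 16 15 a0, patternProb_fc_eq 0 false false 16 17 a1,
    patternProb_fc_eq 0 false false 16 9 a2, patternProb_fc_eq 1 false true 16 15 b0,
    patternProb_fc_eq 1 false true 16 17 b1, patternProb_fc_eq 1 false true 16 9 b2,
    patternProb_fc_eq 4 false true 16 15 d0, patternProb_fc_eq 4 false true 16 17 d1,
    patternProb_fc_eq 4 false true 16 9 d2]
  push_cast
  intro h
  have hτ := tau_sq_add_tau_add_one
  -- reduce the mirror sum with τ² = −1 − τ: it equals (−1 − 23τ)/128, so h forces τ = −1/23, contradicting τ²+τ+1 = 0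
  have hlin : (-1 - 23 * tau) / 128 = 0 := by
    linear_combination h + ((8 * tau ^ 4 - 8 * tau ^ 3 - 10 * tau ^ 2 + 18 * tau - 35) / 128) * hτ
  have hval : tau = -1 / 23 := by linear_combination (-128 / 23) * hlin
  rw [hval] at hτ
  norm_num at hτ


end Literature.Probability.Percolation.FivePoint.S0

end
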